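import Summits.Ventures.LatticeQCDFlow.Exactness.ReversibleVariationalTauInt
import Mathlib.Analysis.Complex.AbelLimit
import HarnessLib

/-!
# A NON-REVERSIBLE exact sampler is never worse than a reversible one with a smaller Dirichlet form: `A_r(g; K) ≤ A_r(g; S)` for every observable (Abel form, unconditional), hence `τ_int(g; K) ≤ τ_int(g; S)`

HONEST FRAMING: exact (Metropolis-corrected) sampling algorithms for lattice gauge theory;
figures of merit are autocorrelation/cost numbers at stated couplings and volumes; no
continuum-physics claim.

Venture `LatticeQCDFlow` (cell pub-lqcd), topic `Exactness`; FANOUT row 8 (`s0-cpn-nemc`, GEN-24).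
NEW WORK of the cell over row 2's format `RevOp` of an exact sampler on an ADMISSIBLE CLASS
(`Exactness/ReversibleOperatorL2.lean`, `ReversibleNeumannSums.lean`, `ReversibleVariationalFloor.lean`,
`ReversibleVariationalTauInt.lean`): weight `w ≥ 0`, class `A` with (int) (comb), operators with
(stab) (lin) (contr) and — for the REVERSIBLE comparison sampler only — (symm).  Only limits of real
sequences and Abel's limit theorem (Mathlib) are used; no spectral theorem, no adjoint operator, no
time reversal is ever constructed.  Nothing is cited as a fact.  Printed counterparts NAMED ONLY:
Sun–Gomez–Schmidhuber 2010 (NIPS) and Bierkens 2016 (Stat. Comput. 26, Prop. 3.1): on a FINITE state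
space every chain has asymptotic variance at most that of its additive reversibilization
`½(P + P̃)` — that finite matrix statement is PROVED in the tree as
`Literature.Probability.MarkovChains.asympVar_le_addReversibilization`.  The comparison theorem of
the cell (`Exactness/ReversibleComparison.lean`, Peskun–Tierney / Caracciolo–Pelissetto–Sokal in Abel
form) lists "non-reversible updates" as NOT CLAIMED; this file supplies them.

## Why this file, and the argument (no adjoint needed)

The cell's `τ_int` floors and comparison theorems are stated for REVERSIBLE samplers, while the
production updates of rows 8 / 21 / 22 are not: sweeps in a fixed site order, HMC with a partial
momentum refresh, the ordered composition "flow proposal then local sweep", lifted updates.  What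
survives is ONE-SIDED: if a reversible `S` of the same target moves AT MOST as much as `K` in quadratic
form — `∫ v (K v) w ≤ ∫ v (S v) w` on `A`, i.e. `𝓔_S ≤ 𝓔_K` with `𝓔(v) = ∫ v² w − ∫ v (K v) w` (equality
for the additive reversibilization when it acts on the class, and — with no adjoint at all — for the
random-order version `½(P₁P₂ + P₂P₁)` of an ordered composition `P₁P₂` of reversible updates,
companion file) — then `K` has the smaller Abel autocorrelation sum FOR EVERY OBSERVABLE of the
(abstract, possibly unbounded) class, with no irreducibility or summability needed.
Proof: with `y_N = Σ_{k<N} rᵏ Kᵏ g`, the symmetry-free resolvent identity `y_N − r K y_N = g − r^N K^N g`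
gives `Q^K_r(y_N) := ∫ y_N² w − r ∫ y_N (K y_N) w = Σ_{k<N} C_K(k) rᵏ − r^N ∫ y_N (K^N g) w → A_r(g; K)`
(`|∫ y_N (K^N g) w| ≤ N ∫ g² w`); the variational floor of `S` at the trial observable `y_N` reads
`(Σ_{k<N} C_K(k) rᵏ)² ≤ A_r(g;S) · Q^S_r(y_N) ≤ A_r(g;S) · Q^K_r(y_N)`, so `A_r(g;K)² ≤ A_r(g;S) A_r(g;K)`
in the limit; Abel's theorem moves the comparison to `r = 1` under summability.

## What is proved (namespace `RevOp`; `C_K(k) = ∫ g (Kᵏ g) w`, `C_S(k)` likewise, `P = ∫ g² w`)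

* `abs_integral_iterate_mul_iterate_le` — `|∫ (Kᵏ g)(Kᵐ g) w| ≤ ∫ g² w` (no symmetry);
  `abs_integral_neumann_mul_iterate_le` — `|∫ y_N (Kᵐ g) w| ≤ N ∫ g² w` for `0 ≤ r ≤ 1`;
* `neumann_quadForm_eq_nonrev` — `Q^K_r(y_N) = Σ_{k<N} C_K(k) rᵏ − r^N ∫ y_N (K^N g) w`;
  `tendsto_neumann_quadForm_nonrev` — `Q^K_r(y_N) → A_r(g; K)` (`0 ≤ r < 1`);
* **`abelSum_nonneg_nonrev`** — `0 ≤ Σ_k C_K(k) rᵏ` for EVERY exact sampler (no reversibility);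
* **`abelSum_le_of_quadForm_le_nonrev`** — THE THEOREM: `K` any exact sampler, `S` reversible, both on
  `A`, `∫ v (K v) w ≤ ∫ v (S v) w` on `A` ⇒ `Σ_k C_K(k) rᵏ ≤ Σ_k C_S(k) rᵏ` for all `g ∈ A`, `0 ≤ r < 1`;
* **`tsum_autocov_le_nonrev`**, **`tauInt_le_nonrev`** — under summability of both normalised series
  (`P > 0`): `Σ_k C_K(k) ≤ Σ_k C_S(k)` and `τ_int(g; K) ≤ τ_int(g; S)` (`Scoring.tauInt`).

NOT CLAIMED: any converse; a comparison between two non-reversible samplers; existence of the additive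
reversibilization as an operator on the class (never used); summability for any run; any number of ours.
-/

namespace Summit.Ventures.LatticeQCDFlow.Exactness

open Real MeasureTheory Filter Finset Topology
open Summit.Ventures.LatticeQCDFlow.Scoring

namespace RevOp

variable {X : Type*} [MeasurableSpace X] {μ : Measure X} {w : X → ℝ} {A : (X → ℝ) → Prop}
  {K S : (X → ℝ) → (X → ℝ)}

/-! ## §1 Symmetry-free Neumann-sum estimates for an exact sampler `K` -/

/-- **`|∫ (Kᵏ g)(Kᵐ g) w| ≤ ∫ g² w`** for every exact sampler (Cauchy–Schwarz and the contraction
property of the iterates; no symmetry). -/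
theorem abs_integral_iterate_mul_iterate_le (hw0 : ∀ x, 0 ≤ w x)
    (hAi : ∀ ⦃f h : X → ℝ⦄, A f → A h → Integrable (fun x => f x * h x * w x) μ)
    (hAK : ∀ ⦃f : X → ℝ⦄, A f → A (K f))
    (hcontr : ∀ ⦃f : X → ℝ⦄, A f → ∫ x, K f x ^ 2 * w x ∂μ ≤ ∫ x, f x ^ 2 * w x ∂μ)
    {g : X → ℝ} (hg : A g) (k m : ℕ) :
    |∫ x, (K^[k] g) x * (K^[m] g) x * w x ∂μ| ≤ ∫ x, g x ^ 2 * w x ∂μ := by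
  have hgk := iterate_mem hAK k hg
  have hgm := iterate_mem hAK m hg
  have hP0 : 0 ≤ ∫ x, g x ^ 2 * w x ∂μ := integral_nonneg fun x => mul_nonneg (sq_nonneg _) (hw0 x)
  have hCS := sq_integral_mul_le hw0 hAi hgk hgm
  have hk := iterate_contr hAK hcontr k hg
  have hm := iterate_contr hAK hcontr m hg
  have h0m : 0 ≤ ∫ x, (K^[m] g) x ^ 2 * w x ∂μ :=
    integral_nonneg fun x => mul_nonneg (sq_nonneg _) (hw0 x)
  have hsq : (∫ x, (K^[k] g) x * (K^[m] g) x * w x ∂μ) ^ 2 ≤ (∫ x, g x ^ 2 * w x ∂μ) ^ 2 := by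
    calc (∫ x, (K^[k] g) x * (K^[m] g) x * w x ∂μ) ^ 2
        ≤ (∫ x, (K^[k] g) x ^ 2 * w x ∂μ) * ∫ x, (K^[m] g) x ^ 2 * w x ∂μ := hCS
      _ ≤ (∫ x, g x ^ 2 * w x ∂μ) * ∫ x, g x ^ 2 * w x ∂μ := mul_le_mul hk hm h0m hP0
      _ = (∫ x, g x ^ 2 * w x ∂μ) ^ 2 := by ring
  exact abs_le.mpr (abs_le_of_sq_le_sq' hsq hP0)

/-- **`|∫ y_N (Kᵐ g) w| ≤ N ∫ g² w`** for the partial Neumann sums `y_N = Σ_{k<N} rᵏ Kᵏ g`,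
`0 ≤ r ≤ 1` (no symmetry). -/
theorem abs_integral_neumann_mul_iterate_le (hw0 : ∀ x, 0 ≤ w x)
    (hAi : ∀ ⦃f h : X → ℝ⦄, A f → A h → Integrable (fun x => f x * h x * w x) μ)
    (hAK : ∀ ⦃f : X → ℝ⦄, A f → A (K f))
    (hcontr : ∀ ⦃f : X → ℝ⦄, A f → ∫ x, K f x ^ 2 * w x ∂μ ≤ ∫ x, f x ^ 2 * w x ∂μ)
    {g : X → ℝ} (hg : A g) {r : ℝ} (hr0 : 0 ≤ r) (hr1 : r ≤ 1) (N m : ℕ) :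
    |∫ x, (∑ k ∈ Finset.range N, r ^ k * (K^[k] g) x) * (K^[m] g) x * w x ∂μ|
      ≤ N * ∫ x, g x ^ 2 * w x ∂μ := by
  rw [integral_sum_mul hAi (fun k => iterate_mem hAK k hg) (iterate_mem hAK m hg) (fun k => r ^ k) N]
  calc |∑ k ∈ Finset.range N, r ^ k * ∫ x, (K^[k] g) x * (K^[m] g) x * w x ∂μ|
      ≤ ∑ k ∈ Finset.range N, |r ^ k * ∫ x, (K^[k] g) x * (K^[m] g) x * w x ∂μ| :=
        Finset.abs_sum_le_sum_abs _ _
    _ ≤ ∑ k ∈ Finset.range N, ∫ x, g x ^ 2 * w x ∂μ := by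
        refine Finset.sum_le_sum fun k _ => ?_
        rw [abs_mul, abs_of_nonneg (pow_nonneg hr0 k)]
        calc r ^ k * |∫ x, (K^[k] g) x * (K^[m] g) x * w x ∂μ|
            ≤ 1 * ∫ x, g x ^ 2 * w x ∂μ :=
              mul_le_mul (pow_le_one₀ hr0 hr1) (abs_integral_iterate_mul_iterate_le hw0 hAi hAK
                hcontr hg k m) (abs_nonneg _) zero_le_one
          _ = ∫ x, g x ^ 2 * w x ∂μ := one_mul _
    _ = N * ∫ x, g x ^ 2 * w x ∂μ := by simp

/-- **The regularised quadratic form at the Neumann sums, for ANY exact sampler**: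
`∫ y_N² w − r ∫ y_N (K y_N) w = Σ_{k<N} C_K(k) rᵏ − r^N ∫ y_N (K^N g) w` (resolvent identity; no
symmetry). -/
theorem neumann_quadForm_eq_nonrev
    (hAi : ∀ ⦃f h : X → ℝ⦄, A f → A h → Integrable (fun x => f x * h x * w x) μ)
    (hAc : ∀ ⦃f h : X → ℝ⦄ (c : ℝ), A f → A h → A (fun x => f x + c * h x))
    (hAK : ∀ ⦃f : X → ℝ⦄, A f → A (K f))
    (hlin : ∀ ⦃f h : X → ℝ⦄ (c : ℝ), A f → A h →
      ∀ x, K (fun s => f s + c * h s) x = K f x + c * K h x)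
    {g : X → ℝ} (hg : A g) (r : ℝ) (N : ℕ) :
    (∫ x, (∑ k ∈ Finset.range N, r ^ k * (K^[k] g) x) ^ 2 * w x ∂μ)
        - r * ∫ x, (∑ k ∈ Finset.range N, r ^ k * (K^[k] g) x)
          * K (fun y => ∑ k ∈ Finset.range N, r ^ k * (K^[k] g) y) x * w x ∂μ
      = (∑ k ∈ Finset.range N, (∫ x, g x * (K^[k] g) x * w x ∂μ) * r ^ k)
        - r ^ N * ∫ x, (∑ k ∈ Finset.range N, r ^ k * (K^[k] g) x) * (K^[N] g) x * w x ∂μ := by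
  have hS := neumann_mem hAc hAK hg r N
  have hgN := iterate_mem hAK N hg
  have iSg := hAi hS hg
  have iSN := hAi hS hgN
  have iS2 : Integrable (fun x => (∑ k ∈ Finset.range N, r ^ k * (K^[k] g) x) ^ 2 * w x) μ :=
    integrable_sq_mul hAi hS
  have iSKS := hAi hS (hAK hS)
  rw [← integral_const_mul, ← integral_sub iS2 (iSKS.const_mul r)]
  have e : ∀ x, (∑ k ∈ Finset.range N, r ^ k * (K^[k] g) x) ^ 2 * w x
      - r * ((∑ k ∈ Finset.range N, r ^ k * (K^[k] g) x)
        * K (fun y => ∑ k ∈ Finset.range N, r ^ k * (K^[k] g) y) x * w x)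
      = (∑ k ∈ Finset.range N, r ^ k * (K^[k] g) x) * g x * w x
        - r ^ N * ((∑ k ∈ Finset.range N, r ^ k * (K^[k] g) x) * (K^[N] g) x * w x) := by
    intro x
    have hres := neumann_sub_op hAc hAK hlin hg r N x
    have : (∑ k ∈ Finset.range N, r ^ k * (K^[k] g) x) ^ 2 * w x
        - r * ((∑ k ∈ Finset.range N, r ^ k * (K^[k] g) x)
          * K (fun y => ∑ k ∈ Finset.range N, r ^ k * (K^[k] g) y) x * w x)
        = (∑ k ∈ Finset.range N, r ^ k * (K^[k] g) x)
          * ((∑ k ∈ Finset.range N, r ^ k * (K^[k] g) x)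
            - r * K (fun y => ∑ k ∈ Finset.range N, r ^ k * (K^[k] g) y) x) * w x := by ring
    rw [this, hres]
    ring
  rw [integral_congr_ae (Eventually.of_forall e), integral_sub iSg (iSN.const_mul _),
    integral_const_mul,
    integral_sum_mul hAi (fun k => iterate_mem hAK k hg) hg (fun k => r ^ k) N]
  have e1 : ∀ k ∈ Finset.range N, r ^ k * ∫ x, (K^[k] g) x * g x * w x ∂μ
      = (∫ x, g x * (K^[k] g) x * w x ∂μ) * r ^ k := by
    intro k _
    have : ∫ x, (K^[k] g) x * g x * w x ∂μ = ∫ x, g x * (K^[k] g) x * w x ∂μ :=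
      integral_congr_ae (Eventually.of_forall fun x => by ring)
    rw [this, mul_comm]
  rw [Finset.sum_congr rfl e1]

/-- **`Q^K_r(y_N) → A_r(g; K)`**: the regularised quadratic form at the Neumann sums converges to the
Abel autocorrelation sum `Σ_k C_K(k) rᵏ`, for EVERY exact sampler (`0 ≤ r < 1`; no symmetry). -/
theorem tendsto_neumann_quadForm_nonrev (hw0 : ∀ x, 0 ≤ w x)
    (hAi : ∀ ⦃f h : X → ℝ⦄, A f → A h → Integrable (fun x => f x * h x * w x) μ)
    (hAc : ∀ ⦃f h : X → ℝ⦄ (c : ℝ), A f → A h → A (fun x => f x + c * h x))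
    (hAK : ∀ ⦃f : X → ℝ⦄, A f → A (K f))
    (hlin : ∀ ⦃f h : X → ℝ⦄ (c : ℝ), A f → A h →
      ∀ x, K (fun s => f s + c * h s) x = K f x + c * K h x)
    (hcontr : ∀ ⦃f : X → ℝ⦄, A f → ∫ x, K f x ^ 2 * w x ∂μ ≤ ∫ x, f x ^ 2 * w x ∂μ)
    {g : X → ℝ} (hg : A g) {r : ℝ} (hr0 : 0 ≤ r) (hr1 : r < 1) :
    Tendsto (fun N : ℕ => (∫ x, (∑ k ∈ Finset.range N, r ^ k * (K^[k] g) x) ^ 2 * w x ∂μ)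
        - r * ∫ x, (∑ k ∈ Finset.range N, r ^ k * (K^[k] g) x)
          * K (fun y => ∑ k ∈ Finset.range N, r ^ k * (K^[k] g) y) x * w x ∂μ)
      atTop (𝓝 (∑' k, (∫ x, g x * (K^[k] g) x * w x ∂μ) * r ^ k)) := by
  set P := ∫ x, g x ^ 2 * w x ∂μ with hP
  set J : ℕ → ℝ := fun N =>
    ∫ x, (∑ k ∈ Finset.range N, r ^ k * (K^[k] g) x) * (K^[N] g) x * w x ∂μ with hJ
  have hNrN : Tendsto (fun N : ℕ => (N : ℝ) * r ^ N) atTop (𝓝 0) :=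
    tendsto_self_mul_const_pow_of_lt_one hr0 hr1
  -- `r^N J_N → 0`
  have h1 : Tendsto (fun N : ℕ => r ^ N * J N) atTop (𝓝 0) := by
    have hb : Tendsto (fun N : ℕ => P * ((N : ℝ) * r ^ N)) atTop (𝓝 0) := by
      simpa using hNrN.const_mul P
    refine squeeze_zero_norm (fun N => ?_) hb
    rw [norm_mul, norm_pow, Real.norm_eq_abs, Real.norm_eq_abs, abs_of_nonneg hr0]
    calc r ^ N * |J N| ≤ r ^ N * ((N : ℝ) * P) :=
          mul_le_mul_of_nonneg_left
            (abs_integral_neumann_mul_iterate_le hw0 hAi hAK hcontr hg hr0 hr1.le N N)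
            (pow_nonneg hr0 N)
      _ = P * ((N : ℝ) * r ^ N) := by ring
  -- the partial Abel sums converge
  have h2 : Tendsto (fun N : ℕ => ∑ k ∈ Finset.range N, (∫ x, g x * (K^[k] g) x * w x ∂μ) * r ^ k)
      atTop (𝓝 (∑' k, (∫ x, g x * (K^[k] g) x * w x ∂μ) * r ^ k)) :=
    (summable_autocov_mul_pow hw0 hAi hAK hcontr hg hr0 hr1).hasSum.tendsto_sum_nat
  have h := h2.sub h1
  rw [sub_zero] at h
  refine h.congr fun N => ?_
  exact (neumann_quadForm_eq_nonrev hAi hAc hAK hlin hg r N).symm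

/-- **THE ABEL AUTOCORRELATION SUM OF EVERY EXACT SAMPLER IS NONNEGATIVE**: `0 ≤ Σ_k C_K(k) rᵏ`
for `g ∈ A`, `0 ≤ r < 1` — no reversibility (it is the limit of the nonnegative regularised
quadratic forms `Q^K_r(y_N)`). -/
theorem abelSum_nonneg_nonrev (hw0 : ∀ x, 0 ≤ w x)
    (hAi : ∀ ⦃f h : X → ℝ⦄, A f → A h → Integrable (fun x => f x * h x * w x) μ)
    (hAc : ∀ ⦃f h : X → ℝ⦄ (c : ℝ), A f → A h → A (fun x => f x + c * h x))
    (hAK : ∀ ⦃f : X → ℝ⦄, A f → A (K f))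
    (hlin : ∀ ⦃f h : X → ℝ⦄ (c : ℝ), A f → A h →
      ∀ x, K (fun s => f s + c * h s) x = K f x + c * K h x)
    (hcontr : ∀ ⦃f : X → ℝ⦄, A f → ∫ x, K f x ^ 2 * w x ∂μ ≤ ∫ x, f x ^ 2 * w x ∂μ)
    {g : X → ℝ} (hg : A g) {r : ℝ} (hr0 : 0 ≤ r) (hr1 : r < 1) :
    0 ≤ ∑' k, (∫ x, g x * (K^[k] g) x * w x ∂μ) * r ^ k :=
  ge_of_tendsto' (tendsto_neumann_quadForm_nonrev hw0 hAi hAc hAK hlin hcontr hg hr0 hr1) fun N =>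
    quadForm_nonneg hw0 hAi hAK hcontr (neumann_mem hAc hAK hg r N) hr0 hr1.le

/-! ## §2 The comparison with a reversible sampler dominated in quadratic form -/

/-- **A NON-REVERSIBLE EXACT SAMPLER BEATS EVERY REVERSIBLE SAMPLER IT DOMINATES IN DIRICHLET FORM
(Abel form, unconditional).**  `K` any exact sampler on the class ((stab) (lin) (contr)), `S` a
REVERSIBLE one ((stab) (lin) (symm) (contr)), same weight `w`; if `∫ v (K v) w ≤ ∫ v (S v) w` for every
`v ∈ A` (i.e. `𝓔_S ≤ 𝓔_K`: `S` moves at most as much as `K` — equality for the additive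
reversibilization and for the random-order version of an ordered composition), then for every `g ∈ A`
and `0 ≤ r < 1`:  **`Σ_k C_K(k) rᵏ ≤ Σ_k C_S(k) rᵏ`**. -/
theorem abelSum_le_of_quadForm_le_nonrev (hw0 : ∀ x, 0 ≤ w x)
    (hAi : ∀ ⦃f h : X → ℝ⦄, A f → A h → Integrable (fun x => f x * h x * w x) μ)
    (hAc : ∀ ⦃f h : X → ℝ⦄ (c : ℝ), A f → A h → A (fun x => f x + c * h x))
    (hAK : ∀ ⦃f : X → ℝ⦄, A f → A (K f))
    (hlin : ∀ ⦃f h : X → ℝ⦄ (c : ℝ), A f → A h →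
      ∀ x, K (fun s => f s + c * h s) x = K f x + c * K h x)
    (hcontr : ∀ ⦃f : X → ℝ⦄, A f → ∫ x, K f x ^ 2 * w x ∂μ ≤ ∫ x, f x ^ 2 * w x ∂μ)
    (hAS : ∀ ⦃f : X → ℝ⦄, A f → A (S f))
    (hlinS : ∀ ⦃f h : X → ℝ⦄ (c : ℝ), A f → A h →
      ∀ x, S (fun s => f s + c * h s) x = S f x + c * S h x)
    (hsymmS : ∀ ⦃f h : X → ℝ⦄, A f → A h →
      ∫ x, S f x * h x * w x ∂μ = ∫ x, f x * S h x * w x ∂μ)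
    (hcontrS : ∀ ⦃f : X → ℝ⦄, A f → ∫ x, S f x ^ 2 * w x ∂μ ≤ ∫ x, f x ^ 2 * w x ∂μ)
    (hdom : ∀ ⦃v : X → ℝ⦄, A v → ∫ x, v x * K v x * w x ∂μ ≤ ∫ x, v x * S v x * w x ∂μ)
    {g : X → ℝ} (hg : A g) {r : ℝ} (hr0 : 0 ≤ r) (hr1 : r < 1) :
    ∑' k, (∫ x, g x * (K^[k] g) x * w x ∂μ) * r ^ k
      ≤ ∑' k, (∫ x, g x * (S^[k] g) x * w x ∂μ) * r ^ k := by
  set AK := ∑' k, (∫ x, g x * (K^[k] g) x * w x ∂μ) * r ^ k with hAKdef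
  set AS := ∑' k, (∫ x, g x * (S^[k] g) x * w x ∂μ) * r ^ k with hASdef
  -- the Abel sum of the reversible sampler is nonnegative
  have hAS0 : 0 ≤ AS := abelSum_nonneg_nonrev hw0 hAi hAc hAS hlinS hcontrS hg hr0 hr1
  -- notation for the Neumann sums of `K`
  set T : ℕ → ℝ := fun N => ∑ k ∈ Finset.range N, (∫ x, g x * (K^[k] g) x * w x ∂μ) * r ^ k
    with hT
  set J : ℕ → ℝ := fun N =>
    ∫ x, (∑ k ∈ Finset.range N, r ^ k * (K^[k] g) x) * (K^[N] g) x * w x ∂μ with hJ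
  -- the `N`-th inequality: `T_N² ≤ AS · (T_N − r^N J_N)`
  have hstep : ∀ N : ℕ, (T N) ^ 2 ≤ AS * (T N - r ^ N * J N) := by
    intro N
    have hy := neumann_mem hAc hAK hg r N
    -- `∫ g y_N w = T_N`
    have hgy : ∫ x, g x * (∑ k ∈ Finset.range N, r ^ k * (K^[k] g) x) * w x ∂μ = T N := by
      have e : ∫ x, g x * (∑ k ∈ Finset.range N, r ^ k * (K^[k] g) x) * w x ∂μ
          = ∫ x, (∑ k ∈ Finset.range N, r ^ k * (K^[k] g) x) * g x * w x ∂μ :=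
        integral_congr_ae (Eventually.of_forall fun x => by ring)
      rw [e, integral_sum_mul hAi (fun k => iterate_mem hAK k hg) hg (fun k => r ^ k) N]
      refine Finset.sum_congr rfl fun k _ => ?_
      have : ∫ x, (K^[k] g) x * g x * w x ∂μ = ∫ x, g x * (K^[k] g) x * w x ∂μ :=
        integral_congr_ae (Eventually.of_forall fun x => by ring)
      rw [this, mul_comm]
    -- the variational floor of `S` at the trial observable `y_N`
    have hfloor := sq_inner_le_abelSum_mul_quadForm hw0 hAi hAc hAS hlinS hsymmS hcontrS hg hy hr0 hr1
    rw [hgy] at hfloor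
    -- `Q^S_r(y_N) ≤ Q^K_r(y_N) = T_N − r^N J_N`
    have hQ : (∫ x, (∑ k ∈ Finset.range N, r ^ k * (K^[k] g) x) ^ 2 * w x ∂μ)
        - r * ∫ x, (∑ k ∈ Finset.range N, r ^ k * (K^[k] g) x)
          * S (fun y => ∑ k ∈ Finset.range N, r ^ k * (K^[k] g) y) x * w x ∂μ
        ≤ T N - r ^ N * J N := by
      rw [← neumann_quadForm_eq_nonrev hAi hAc hAK hlin hg r N]
      have := hdom hy
      nlinarith
    exact hfloor.trans (mul_le_mul_of_nonneg_left hQ hAS0)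
  -- limits
  have hNrN : Tendsto (fun N : ℕ => (N : ℝ) * r ^ N) atTop (𝓝 0) :=
    tendsto_self_mul_const_pow_of_lt_one hr0 hr1
  have hP0 : 0 ≤ ∫ x, g x ^ 2 * w x ∂μ := integral_nonneg fun x => mul_nonneg (sq_nonneg _) (hw0 x)
  have h1 : Tendsto (fun N : ℕ => r ^ N * J N) atTop (𝓝 0) := by
    have hb : Tendsto (fun N : ℕ => (∫ x, g x ^ 2 * w x ∂μ) * ((N : ℝ) * r ^ N)) atTop (𝓝 0) := by
      simpa using hNrN.const_mul (∫ x, g x ^ 2 * w x ∂μ)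
    refine squeeze_zero_norm (fun N => ?_) hb
    rw [norm_mul, norm_pow, Real.norm_eq_abs, Real.norm_eq_abs, abs_of_nonneg hr0]
    calc r ^ N * |J N| ≤ r ^ N * ((N : ℝ) * ∫ x, g x ^ 2 * w x ∂μ) :=
          mul_le_mul_of_nonneg_left
            (abs_integral_neumann_mul_iterate_le hw0 hAi hAK hcontr hg hr0 hr1.le N N)
            (pow_nonneg hr0 N)
      _ = (∫ x, g x ^ 2 * w x ∂μ) * ((N : ℝ) * r ^ N) := by ring
  have h2 : Tendsto T atTop (𝓝 AK) :=
    (summable_autocov_mul_pow hw0 hAi hAK hcontr hg hr0 hr1).hasSum.tendsto_sum_nat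
  have hL : Tendsto (fun N => (T N) ^ 2) atTop (𝓝 (AK ^ 2)) := h2.pow 2
  have hR : Tendsto (fun N => AS * (T N - r ^ N * J N)) atTop (𝓝 (AS * AK)) := by
    have := (h2.sub h1).const_mul AS
    rw [sub_zero] at this
    exact this
  have hlim : AK ^ 2 ≤ AS * AK := le_of_tendsto_of_tendsto' hL hR hstep
  -- conclude
  rcases le_or_gt AK 0 with hneg | hpos
  · exact hneg.trans hAS0
  · exact le_of_mul_le_mul_right (by nlinarith [hlim]) hpos

/-! ## §3 At `r = 1` under summability: `Σ_k C_K(k) ≤ Σ_k C_S(k)` and `τ_int(g; K) ≤ τ_int(g; S)` -/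

/-- **`Σ_k C_K(k) ≤ Σ_k C_S(k)`** for the non-reversible `K` and the reversible `S` with `𝓔_S ≤ 𝓔_K`
on `A`, when `∫ g² w > 0` and both normalised autocorrelation series are summable (Abel's limit
theorem on both sides of the Abel-form comparison). -/
theorem tsum_autocov_le_nonrev (hw0 : ∀ x, 0 ≤ w x)
    (hAi : ∀ ⦃f h : X → ℝ⦄, A f → A h → Integrable (fun x => f x * h x * w x) μ)
    (hAc : ∀ ⦃f h : X → ℝ⦄ (c : ℝ), A f → A h → A (fun x => f x + c * h x))
    (hAK : ∀ ⦃f : X → ℝ⦄, A f → A (K f))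
    (hlin : ∀ ⦃f h : X → ℝ⦄ (c : ℝ), A f → A h →
      ∀ x, K (fun s => f s + c * h s) x = K f x + c * K h x)
    (hcontr : ∀ ⦃f : X → ℝ⦄, A f → ∫ x, K f x ^ 2 * w x ∂μ ≤ ∫ x, f x ^ 2 * w x ∂μ)
    (hAS : ∀ ⦃f : X → ℝ⦄, A f → A (S f))
    (hlinS : ∀ ⦃f h : X → ℝ⦄ (c : ℝ), A f → A h →
      ∀ x, S (fun s => f s + c * h s) x = S f x + c * S h x)
    (hsymmS : ∀ ⦃f h : X → ℝ⦄, A f → A h →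
      ∫ x, S f x * h x * w x ∂μ = ∫ x, f x * S h x * w x ∂μ)
    (hcontrS : ∀ ⦃f : X → ℝ⦄, A f → ∫ x, S f x ^ 2 * w x ∂μ ≤ ∫ x, f x ^ 2 * w x ∂μ)
    (hdom : ∀ ⦃v : X → ℝ⦄, A v → ∫ x, v x * K v x * w x ∂μ ≤ ∫ x, v x * S v x * w x ∂μ)
    {g : X → ℝ} (hg : A g) (hP : 0 < ∫ x, g x ^ 2 * w x ∂μ)
    (hsK : Summable fun n => (∫ x, g x * (K^[n + 1] g) x * w x ∂μ) / ∫ x, g x ^ 2 * w x ∂μ)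
    (hsS : Summable fun n => (∫ x, g x * (S^[n + 1] g) x * w x ∂μ) / ∫ x, g x ^ 2 * w x ∂μ) :
    ∑' k, ∫ x, g x * (K^[k] g) x * w x ∂μ ≤ ∑' k, ∫ x, g x * (S^[k] g) x * w x ∂μ := by
  set CK : ℕ → ℝ := fun k => ∫ x, g x * (K^[k] g) x * w x ∂μ with hCK
  set CS : ℕ → ℝ := fun k => ∫ x, g x * (S^[k] g) x * w x ∂μ with hCS
  set P := ∫ x, g x ^ 2 * w x ∂μ with hPdef
  have hsρK : Summable fun k => CK k / P := (summable_nat_add_iff 1).1 hsK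
  have hsCK : Summable CK := (hsρK.mul_left P).congr fun k => by field_simp
  have hsρS : Summable fun k => CS k / P := (summable_nat_add_iff 1).1 hsS
  have hsCS : Summable CS := (hsρS.mul_left P).congr fun k => by field_simp
  have habelK : Tendsto (fun x : ℝ => ∑' k, CK k * x ^ k) (𝓝[<] 1) (𝓝 (∑' k, CK k)) :=
    Real.tendsto_tsum_powerSeries_nhdsWithin_lt hsCK.hasSum.tendsto_sum_nat
  have habelS : Tendsto (fun x : ℝ => ∑' k, CS k * x ^ k) (𝓝[<] 1) (𝓝 (∑' k, CS k)) :=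
    Real.tendsto_tsum_powerSeries_nhdsWithin_lt hsCS.hasSum.tendsto_sum_nat
  have hev : ∀ᶠ r in 𝓝[<] (1 : ℝ), ∑' k, CK k * r ^ k ≤ ∑' k, CS k * r ^ k := by
    filter_upwards [Ioo_mem_nhdsLT (show (0 : ℝ) < 1 by norm_num)] with r hr
    exact abelSum_le_of_quadForm_le_nonrev hw0 hAi hAc hAK hlin hcontr hAS hlinS hsymmS hcontrS hdom
      hg hr.1.le hr.2
  exact le_of_tendsto_of_tendsto habelK habelS hev

/-- **THE COMPARISON THEOREM FOR `τ_int` WITHOUT REVERSIBILITY OF THE BETTER SAMPLER.**  `K` any exact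
sampler, `S` reversible, `∫ v (K v) w ≤ ∫ v (S v) w` on `A`; `g ∈ A` with `∫ g² w > 0` and both
normalised autocorrelation series summable.  Then **`τ_int(g; K) ≤ τ_int(g; S)`** (`Scoring.tauInt`,
`τ_int = ½ + Σ_{k≥1} ρ(k)`). -/
theorem tauInt_le_nonrev (hw0 : ∀ x, 0 ≤ w x)
    (hAi : ∀ ⦃f h : X → ℝ⦄, A f → A h → Integrable (fun x => f x * h x * w x) μ)
    (hAc : ∀ ⦃f h : X → ℝ⦄ (c : ℝ), A f → A h → A (fun x => f x + c * h x))
    (hAK : ∀ ⦃f : X → ℝ⦄, A f → A (K f))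
    (hlin : ∀ ⦃f h : X → ℝ⦄ (c : ℝ), A f → A h →
      ∀ x, K (fun s => f s + c * h s) x = K f x + c * K h x)
    (hcontr : ∀ ⦃f : X → ℝ⦄, A f → ∫ x, K f x ^ 2 * w x ∂μ ≤ ∫ x, f x ^ 2 * w x ∂μ)
    (hAS : ∀ ⦃f : X → ℝ⦄, A f → A (S f))
    (hlinS : ∀ ⦃f h : X → ℝ⦄ (c : ℝ), A f → A h →
      ∀ x, S (fun s => f s + c * h s) x = S f x + c * S h x)
    (hsymmS : ∀ ⦃f h : X → ℝ⦄, A f → A h →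
      ∫ x, S f x * h x * w x ∂μ = ∫ x, f x * S h x * w x ∂μ)
    (hcontrS : ∀ ⦃f : X → ℝ⦄, A f → ∫ x, S f x ^ 2 * w x ∂μ ≤ ∫ x, f x ^ 2 * w x ∂μ)
    (hdom : ∀ ⦃v : X → ℝ⦄, A v → ∫ x, v x * K v x * w x ∂μ ≤ ∫ x, v x * S v x * w x ∂μ)
    {g : X → ℝ} (hg : A g) (hP : 0 < ∫ x, g x ^ 2 * w x ∂μ)
    (hsK : Summable fun n => (∫ x, g x * (K^[n + 1] g) x * w x ∂μ) / ∫ x, g x ^ 2 * w x ∂μ)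
    (hsS : Summable fun n => (∫ x, g x * (S^[n + 1] g) x * w x ∂μ) / ∫ x, g x ^ 2 * w x ∂μ) :
    tauInt (fun n => (∫ x, g x * (K^[n] g) x * w x ∂μ) / ∫ x, g x ^ 2 * w x ∂μ)
      ≤ tauInt (fun n => (∫ x, g x * (S^[n] g) x * w x ∂μ) / ∫ x, g x ^ 2 * w x ∂μ) := by
  set CK : ℕ → ℝ := fun k => ∫ x, g x * (K^[k] g) x * w x ∂μ with hCK
  set CS : ℕ → ℝ := fun k => ∫ x, g x * (S^[k] g) x * w x ∂μ with hCS
  set P := ∫ x, g x ^ 2 * w x ∂μ with hPdef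
  have hmain := tsum_autocov_le_nonrev hw0 hAi hAc hAK hlin hcontr hAS hlinS hsymmS hcontrS hdom hg hP
    hsK hsS
  have hsρK : Summable fun k => CK k / P := (summable_nat_add_iff 1).1 hsK
  have hsρS : Summable fun k => CS k / P := (summable_nat_add_iff 1).1 hsS
  have hCK0 : CK 0 = P := by
    simp only [hCK, hPdef, Function.iterate_zero, id_eq]
    exact integral_congr_ae (Eventually.of_forall fun x => by ring)
  have hCS0 : CS 0 = P := by
    simp only [hCS, hPdef, Function.iterate_zero, id_eq]
    exact integral_congr_ae (Eventually.of_forall fun x => by ring)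
  have hK : ∑' k, CK k / P = tauInt (fun n => CK n / P) + 1 / 2 := by
    rw [hsρK.tsum_eq_zero_add, hCK0, div_self hP.ne']
    simp only [tauInt]
    ring
  have hS' : ∑' k, CS k / P = tauInt (fun n => CS n / P) + 1 / 2 := by
    rw [hsρS.tsum_eq_zero_add, hCS0, div_self hP.ne']
    simp only [tauInt]
    ring
  have hdivK : (∑' k, CK k / P) = (∑' k, CK k) / P := tsum_div_const
  have hdivS : (∑' k, CS k / P) = (∑' k, CS k) / P := tsum_div_const
  have h : (∑' k, CK k) / P ≤ (∑' k, CS k) / P := div_le_div_of_nonneg_right hmain hP.le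
  rw [← hdivK, ← hdivS, hK, hS'] at h
  linarith

end RevOp

end Summit.Ventures.LatticeQCDFlow.Exactness
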